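import Literature.AnabelianGeometry.EtaleTheta.InducesOnThetaInstancesChiCusp
import HarnessLib

/-!
# [EtTh] Cor 2.8 (i) at the cusped inversion model `χ′`, inner case, II: abc-iut-f-151's END-KNIT and its ∃-forms at THE cover
# of record RE-KEYED with the binders `hYmap`, `hYuu` DISCHARGED (every inner `γ_y`, `y ∈ Π^tp_C`; proof-only)

S. Mochizuki, *The étale theta function and its Frobenioid-theoretic manifestations* [EtTh], Publ. RIMS **45** (2009)
(refereed), §2, Cor 2.8 (i) PRIMS PDF p.42 («The isomorphism `γ` preserves the property that `η̲̈^{Θ,l·ℤ×μ₂}` (respectively,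
`η̈^{Θ,ℤ×μ₂}`; `η̲̈^{Θ,l·ℤ×μ₂}`; `η̈^{Θ,l·ℤ×μ₂}`) be of standard type — a property that determines this collection of classes up
to multiplication by a root of unity of order `l` (respectively, 1; `l`; 1)»; proof p.42: «… Now assertion (i) follows immediately
from Theorem 1.10, (i), and the definitions»), Prop 2.4 p.38 (the tower), Def 2.7 p.41 (bib key `MochizukiEtTh2009`; own render
`paper:doi-10-2977-prims-1234361159` p0042).

PROOF-ONLY companion (0 `def`, 0 `instance`, 0 notation, no new `Prop`; cell abc-iut, block F, seat abc-iut-f-193 gen 14; row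
**F-0643** `ThetaOrbitData.InducesOnTheta`, node EtTh:Cor2.8(i); sequel of this seat's `InducesOnThetaInstancesChiCusp` (Part I:
`Π^tp_Ÿ ⊴ Π^tp_C` at abc-iut-L2-d3's section-route cover over abc-iut-w5-d140's `MuTwoSetting.inversionModelχ′`, the binders `hYmap` /
`hYuu` as theorems, the F-0643 head form `γ_y` induces `act y`); every input BY NAME, nothing restated).
* §4 **`SettingModel.cor28_i_innerAutTop_endKnit_inversionModelχ'_of_induces`** — abc-iut-f-151's
  `cor28_i_innerAutTop_endKnit_inversionModelχ'` (the BODY of abc-iut-L2-t2's `Cor28_i` for every inner `γ_y` at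
  `ofEmbedding (orbitEmbeddingOfHuuOfSection …)`: C1 standard type preserved; C2 `η̲̈^{Θ,l·ℤ×μ₂}` up to `μ_l` under tower
  stability; C3/C4 `η̈^{Θ,ℤ×μ₂}` / `η̈^{Θ,l·ℤ×μ₂}` exactly under the printed stability lists) with its binders `hYmap : γ_y(Π^tp_Ÿ) = Π^tp_Ÿ`
  (Part I, for EVERY `y`) and `hYuu : γ_y(Π^tp_Ÿ ∩ Π^tp_{X̲̲}) = Π^tp_Ÿ ∩ Π^tp_{X̲̲}` (Part I, from the `Π^tp_{X̲̲}`-entry of clause C2's OWN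
  tower premise) DISCHARGED.  Residual for inner `γ_y` at χ′: the coefficient automorphism `Γ_Θ` with `InducesOnTheta γ_y Γ_Θ`
  (inhabited exactly once, Part I §3), the slot condition behind `IsStandard`, and the clauses' own stability premises — nothing
  else.  Proof = abc-iut-f-151's, with the two binders supplied (inputs BY NAME: abc-iut-f-151 `IsStandard` + Rmk 2.1.1 normaliser,
  abc-iut-w6-d083 model P-C5, abc-iut-w6-d049 outer transports, abc-iut-w6-d050 junction, abc-iut-w6-d051 stabilities);
* §5 the binder-free ∃-forms at THE cover of record (`…_inversionModelχ'`: `p ≡ 1 (mod 4)`, Def-1.9 pair `τ^{±1} = tauχ′/tauInvχ′`;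
  `…_all`: every prime `p`, both slots the anchored point `Ü = 1 + p` — HONEST LABEL: a slot filling) re-keyed the same way:
  `IsStandard ∧ Π^tp_Ÿ ⊴ Π^tp_C ∧ ∀ y, (∃! Γ_Θ induced by γ_y) ∧ ∀ Γ_Θ induced, ∃ hYmap, C1 ∧ (tower-stable → C2) ∧ (… → C3) ∧ (… → C4)`
  (abc-iut-f-151's forms quantified `∀ hYmap hYuu`; here the binders are shown to EXIST).
WHAT IS NOT CLAIMED: non-inner `Γ` (abc-iut-L2-t1's `Sec2Cor28iCoverOfRecordThetaRigidityAlone`, modulo unit-free theta rigidity);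
the universal closures of `InducesOnTheta` / `Cor28_i` over the interface are refuted (abc-iut-w4-d051) — instance forms only.
HONEST FRAMING: semi-synthetic model = consistency / non-vacuity evidence for the TYPED interface; [EtTh] is refereed and nothing of
it is asserted beyond the displayed statements; no side is taken on [IUTchIII] Cor 3.12; typed ≠ proved; instantiated ≠ endorsed;
nothing here bears on abc itself.
-/

noncomputable section

namespace Literature.AnabelianGeometry.EtaleTheta

open Literature.AnabelianGeometry.SemiGraphs ThetaCovers Literature.IUT.HodgeArakelov
open _root_.Topology _root_.Function
open ThetaSetting.EtaleThetaData.DoubleUnderline.OrbitEmbedding (symm_toTheta_eq)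

namespace SettingModel

variable (p : ℕ) [Fact p.Prime]

/-! ## §4. The END-KNIT re-keyed: `hYmap`, `hYuu` DISCHARGED (inner `γ_y`, every `y ∈ Π^tp_C`) -/

section EndKnit

variable {PC : Type} [Group PC] [TopologicalSpace PC] [IsTopologicalGroup PC] [T2Space PC]
variable (e : (MuTwoSetting.inversionModelχ' p).CLevelData)
  (ιC : (MuTwoSetting.inversionModelχ' p).GtpC →ₜ* PC) (hιC : IsProfiniteCompletion ιC)
  (hinj : Function.Injective ιC) (op : (MuTwoSetting.inversionModelχ' p).toThetaSetting.OncePuncturedData)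
  {l : ℕ+} (hodd : Odd ((l : ℕ+) : ℕ))
  (s : ↥(MuTwoSetting.inversionModelχ' p).GK →* (MuTwoSetting.inversionModelχ' p).PiTemp)
  (hsa : ∀ σ, (MuTwoSetting.inversionModelχ' p).aug (s σ) = (σ : GQp p))
  (hsZ : ∀ σ, (MuTwoSetting.inversionModelχ' p).toZ (s σ) = 1)
  (hιell : ∀ c ∈ (e.piCDataOf ιC hιC).augGK.ker, c ∉ (e.piCDataOf ιC hιC).PiX →
    ∀ d ∈ (e.piCDataOf ιC hιC).PiX ⊓ (e.piCDataOf ιC hιC).augGK.ker,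
      c * d * c⁻¹ * d ∈ (e.piCDataOf ιC hιC).barTheta l)
  (hN : (((MuTwoSetting.inversionModelχ' p).GtpXu l).map (MuTwoSetting.inversionModelχ' p).inclX).Normal)
  (hY : ((MuTwoSetting.inversionModelχ' p).GtpY.map (MuTwoSetting.inversionModelχ' p).inclX).Normal)
  {E : (MuTwoSetting.inversionModelχ' p).toThetaSetting.EtaleThetaData} (hE : E.etaDd = etaDdχ p)
  (C : E.DoubleUnderline (l : ℕ)) (hC : C.Huu = Huuχ p l)
  (hK : (MuTwoSetting.inversionModelχ' p).barKerTp l ≤ C.Huu) (hsH : ∀ σ, s σ ∈ C.Huu)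
  (hι : C.IotaStable (e.conjX (epsPMInvχ p)))
  (τ τ' : ThetaSetting.NonCuspidalPoint E.toKummerData)

include hE hC

/-- **[EtTh] Cor 2.8 (i), the BODY of abc-iut-L2-t2's `Cor28_i` for every INNER `γ_y`, `y ∈ Π^tp_C`, at the section-route
cover over `χ′` — abc-iut-f-151's `cor28_i_innerAutTop_endKnit_inversionModelχ'` with its binders `hYmap` (now §2, a theorem for
EVERY `y`) and `hYuu` (§1–§2, from the `Π^tp_{X̲̲}`-entry of clause C2's own tower premise) DISCHARGED.**  Residual: the coefficient
automorphism `Γ_Θ` with `InducesOnTheta γ_y Γ_Θ` (inhabited exactly once, §3), the slot condition `hτ` behind `IsStandard`, and the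
clauses' own stability premises — nothing else.  (C1) `γ_y` preserves «of standard type» for `η̈^{Θ,ℤ×μ₂}`; (C2) under
`T.tower`-stability `η̲̈^{Θ,l·ℤ×μ₂}` is determined up to `μ_l` (indeed exactly); (C3)/(C4) under the printed stability lists
`η̈^{Θ,ℤ×μ₂}` / `η̈^{Θ,l·ℤ×μ₂}` are determined exactly.  Proof = abc-iut-f-151's (model P-C5 abc-iut-w6-d083, outer transports
abc-iut-w6-d049, junction abc-iut-w6-d050, stabilities abc-iut-w6-d051 — all BY NAME) with the two binders supplied.
[cite: MochizukiEtTh2009, Cor 2.8(i) p.42] -/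
theorem cor28_i_innerAutTop_endKnit_inversionModelχ'_of_induces (u : (↥(ThetaSetting.modelχ p).Kdd)ˣ)
    (hτ : τ.Dpt ≤ (ThetaSetting.modelχ p).GKdd.map (sectionOfUnitχ p u))
    (y : (e.temperedCoverDataOfHuuOfSection ιC hιC hinj op hodd s hsa hsZ hιell hN hY C hK hsH
            (epsPMInvχ_not_mem_range p) hι).Gtp)
    (ΓΘ : (ThetaOrbitData.ofEmbedding
          (e.orbitEmbeddingOfHuuOfSection ιC hιC hinj op hodd s hsa hsZ hιell hN hY C hK hsH (epsPMInvχ_not_mem_range p) hι τ τ')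
          (MuTwoSetting.inversionModelχ'_compat p) (ThetaSetting.modelχ'_sec2Hyps p)).DeltaTheta ≃*
      (ThetaOrbitData.ofEmbedding
          (e.orbitEmbeddingOfHuuOfSection ιC hιC hinj op hodd s hsa hsZ hιell hN hY C hK hsH (epsPMInvχ_not_mem_range p) hι τ τ')
          (MuTwoSetting.inversionModelχ'_compat p) (ThetaSetting.modelχ'_sec2Hyps p)).DeltaTheta)
    (hind : (ThetaOrbitData.ofEmbedding
          (e.orbitEmbeddingOfHuuOfSection ιC hιC hinj op hodd s hsa hsZ hιell hN hY C hK hsH (epsPMInvχ_not_mem_range p) hι τ τ')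
          (MuTwoSetting.inversionModelχ'_compat p) (ThetaSetting.modelχ'_sec2Hyps p)).InducesOnTheta
      (ThetaOrbitData.innerAutTop y) ΓΘ) :
    -- (C1) "`γ` preserves the property … of standard type" (`hYmap` supplied by §2)
    (ThetaOrbitData.ofEmbedding
          (e.orbitEmbeddingOfHuuOfSection ιC hιC hinj op hodd s hsa hsZ hιell hN hY C hK hsH (epsPMInvχ_not_mem_range p) hι τ τ')
          (MuTwoSetting.inversionModelχ'_compat p) (ThetaSetting.modelχ'_sec2Hyps p)).IsStandardColl
      ((ThetaOrbitData.ofEmbedding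
          (e.orbitEmbeddingOfHuuOfSection ιC hιC hinj op hodd s hsa hsZ hιell hN hY C hK hsH (epsPMInvχ_not_mem_range p) hι τ τ')
          (MuTwoSetting.inversionModelχ'_compat p) (ThetaSetting.modelχ'_sec2Hyps p)).transport _
        (ThetaOrbitData.innerAutTop y)
        (map_PiYddtp_innerAutTop_ofHuuOfSection p e ιC hιC hinj op hodd s hsa hsZ hιell hN hY C hK hsH (epsPMInvχ_not_mem_range p) hι y) ΓΘ
        (ThetaOrbitData.ofEmbedding
          (e.orbitEmbeddingOfHuuOfSection ιC hιC hinj op hodd s hsa hsZ hιell hN hY C hK hsH (epsPMInvχ_not_mem_range p) hι τ τ')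
          (MuTwoSetting.inversionModelχ'_compat p) (ThetaSetting.modelχ'_sec2Hyps p)).etaZMu2) ∧
    -- (C2) `η̲̈^{Θ,l·ℤ×μ₂}`, order `l`, under tower stability (`hYuu` supplied by §1 from that very premise)
    (∀ htw : (∀ S ∈ (e.temperedCoverDataOfHuuOfSection ιC hιC hinj op hodd s hsa hsZ hιell hN hY C hK hsH
            (epsPMInvχ_not_mem_range p) hι).tower,
        S.map (ThetaOrbitData.innerAutTop y).toMulEquiv.toMonoidHom = S),
      (ThetaOrbitData.ofEmbedding
          (e.orbitEmbeddingOfHuuOfSection ιC hιC hinj op hodd s hsa hsZ hιell hN hY C hK hsH (epsPMInvχ_not_mem_range p) hι τ τ')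
          (MuTwoSetting.inversionModelχ'_compat p) (ThetaSetting.modelχ'_sec2Hyps p)).EqUpToRootOfUnity l _
        (ThetaOrbitData.ofEmbedding
          (e.orbitEmbeddingOfHuuOfSection ιC hιC hinj op hodd s hsa hsZ hιell hN hY C hK hsH (epsPMInvχ_not_mem_range p) hι τ τ')
          (MuTwoSetting.inversionModelχ'_compat p) (ThetaSetting.modelχ'_sec2Hyps p)).rootLZMu2
        ((ThetaOrbitData.ofEmbedding
          (e.orbitEmbeddingOfHuuOfSection ιC hιC hinj op hodd s hsa hsZ hιell hN hY C hK hsH (epsPMInvχ_not_mem_range p) hι τ τ')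
          (MuTwoSetting.inversionModelχ'_compat p) (ThetaSetting.modelχ'_sec2Hyps p)).transport _
          (ThetaOrbitData.innerAutTop y)
          (ThetaCovers.TemperedCoverData.map_PiYddtp_inf_tp_PiXuu_eq_of_tower (e.temperedCoverDataOfHuuOfSection ιC hιC hinj op hodd s hsa hsZ hιell hN hY C hK hsH
            (epsPMInvχ_not_mem_range p) hι) (ThetaOrbitData.innerAutTop y) htw) ΓΘ
          (ThetaOrbitData.ofEmbedding
          (e.orbitEmbeddingOfHuuOfSection ιC hιC hinj op hodd s hsa hsZ hιell hN hY C hK hsH (epsPMInvχ_not_mem_range p) hι τ τ')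
          (MuTwoSetting.inversionModelχ'_compat p) (ThetaSetting.modelχ'_sec2Hyps p)).rootLZMu2)) ∧
    -- (C3) `η̈^{Θ,ℤ×μ₂}`, order `1`
    ((∀ S ∈ [(e.temperedCoverDataOfHuuOfSection ιC hιC hinj op hodd s hsa hsZ hιell hN hY C hK hsH
            (epsPMInvχ_not_mem_range p) hι).tp
          (e.temperedCoverDataOfHuuOfSection ιC hιC hinj op hodd s hsa hsZ hιell hN hY C hK hsH
            (epsPMInvχ_not_mem_range p) hι).PiXu,
        (e.temperedCoverDataOfHuuOfSection ιC hιC hinj op hodd s hsa hsZ hιell hN hY C hK hsH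
            (epsPMInvχ_not_mem_range p) hι).tp
          (e.temperedCoverDataOfHuuOfSection ιC hιC hinj op hodd s hsa hsZ hιell hN hY C hK hsH
            (epsPMInvχ_not_mem_range p) hι).PiX,
        (e.temperedCoverDataOfHuuOfSection ιC hιC hinj op hodd s hsa hsZ hιell hN hY C hK hsH
            (epsPMInvχ_not_mem_range p) hι).PiYddtp],
          S.map (ThetaOrbitData.innerAutTop y).toMulEquiv.toMonoidHom = S) →
      (ThetaOrbitData.ofEmbedding
          (e.orbitEmbeddingOfHuuOfSection ιC hιC hinj op hodd s hsa hsZ hιell hN hY C hK hsH (epsPMInvχ_not_mem_range p) hι τ τ')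
          (MuTwoSetting.inversionModelχ'_compat p) (ThetaSetting.modelχ'_sec2Hyps p)).EqUpToRootOfUnity 1 _
        (ThetaOrbitData.ofEmbedding
          (e.orbitEmbeddingOfHuuOfSection ιC hιC hinj op hodd s hsa hsZ hιell hN hY C hK hsH (epsPMInvχ_not_mem_range p) hι τ τ')
          (MuTwoSetting.inversionModelχ'_compat p) (ThetaSetting.modelχ'_sec2Hyps p)).etaZMu2
        ((ThetaOrbitData.ofEmbedding
          (e.orbitEmbeddingOfHuuOfSection ιC hιC hinj op hodd s hsa hsZ hιell hN hY C hK hsH (epsPMInvχ_not_mem_range p) hι τ τ')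
          (MuTwoSetting.inversionModelχ'_compat p) (ThetaSetting.modelχ'_sec2Hyps p)).transport _
          (ThetaOrbitData.innerAutTop y)
          (map_PiYddtp_innerAutTop_ofHuuOfSection p e ιC hιC hinj op hodd s hsa hsZ hιell hN hY C hK hsH (epsPMInvχ_not_mem_range p) hι y) ΓΘ
          (ThetaOrbitData.ofEmbedding
          (e.orbitEmbeddingOfHuuOfSection ιC hιC hinj op hodd s hsa hsZ hιell hN hY C hK hsH (epsPMInvχ_not_mem_range p) hι τ τ')
          (MuTwoSetting.inversionModelχ'_compat p) (ThetaSetting.modelχ'_sec2Hyps p)).etaZMu2)) ∧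
    -- (C4) `η̈^{Θ,l·ℤ×μ₂}`, order `1`
    ((∀ S ∈ [(e.temperedCoverDataOfHuuOfSection ιC hιC hinj op hodd s hsa hsZ hιell hN hY C hK hsH
            (epsPMInvχ_not_mem_range p) hι).tp
          (e.temperedCoverDataOfHuuOfSection ιC hιC hinj op hodd s hsa hsZ hιell hN hY C hK hsH
            (epsPMInvχ_not_mem_range p) hι).PiCu,
        (e.temperedCoverDataOfHuuOfSection ιC hιC hinj op hodd s hsa hsZ hιell hN hY C hK hsH
            (epsPMInvχ_not_mem_range p) hι).tp
          (e.temperedCoverDataOfHuuOfSection ιC hιC hinj op hodd s hsa hsZ hιell hN hY C hK hsH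
            (epsPMInvχ_not_mem_range p) hι).PiXu,
        (e.temperedCoverDataOfHuuOfSection ιC hιC hinj op hodd s hsa hsZ hιell hN hY C hK hsH
            (epsPMInvχ_not_mem_range p) hι).tp
          (e.temperedCoverDataOfHuuOfSection ιC hιC hinj op hodd s hsa hsZ hιell hN hY C hK hsH
            (epsPMInvχ_not_mem_range p) hι).PiX,
        (e.temperedCoverDataOfHuuOfSection ιC hιC hinj op hodd s hsa hsZ hιell hN hY C hK hsH
            (epsPMInvχ_not_mem_range p) hι).PiYddtp],
          S.map (ThetaOrbitData.innerAutTop y).toMulEquiv.toMonoidHom = S) →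
      (ThetaOrbitData.ofEmbedding
          (e.orbitEmbeddingOfHuuOfSection ιC hιC hinj op hodd s hsa hsZ hιell hN hY C hK hsH (epsPMInvχ_not_mem_range p) hι τ τ')
          (MuTwoSetting.inversionModelχ'_compat p) (ThetaSetting.modelχ'_sec2Hyps p)).EqUpToRootOfUnity 1 _
        (ThetaOrbitData.ofEmbedding
          (e.orbitEmbeddingOfHuuOfSection ιC hιC hinj op hodd s hsa hsZ hιell hN hY C hK hsH (epsPMInvχ_not_mem_range p) hι τ τ')
          (MuTwoSetting.inversionModelχ'_compat p) (ThetaSetting.modelχ'_sec2Hyps p)).etaLZMu2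
        ((ThetaOrbitData.ofEmbedding
          (e.orbitEmbeddingOfHuuOfSection ιC hιC hinj op hodd s hsa hsZ hιell hN hY C hK hsH (epsPMInvχ_not_mem_range p) hι τ τ')
          (MuTwoSetting.inversionModelχ'_compat p) (ThetaSetting.modelχ'_sec2Hyps p)).transport _
          (ThetaOrbitData.innerAutTop y)
          (map_PiYddtp_innerAutTop_ofHuuOfSection p e ιC hιC hinj op hodd s hsa hsZ hιell hN hY C hK hsH (epsPMInvχ_not_mem_range p) hι y) ΓΘ
          (ThetaOrbitData.ofEmbedding
          (e.orbitEmbeddingOfHuuOfSection ιC hιC hinj op hodd s hsa hsZ hιell hN hY C hK hsH (epsPMInvχ_not_mem_range p) hι τ τ')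
          (MuTwoSetting.inversionModelχ'_compat p) (ThetaSetting.modelχ'_sec2Hyps p)).etaLZMu2)) := by
  -- proof adapted from abc-iut-f-151's `cor28_i_innerAutTop_endKnit_inversionModelχ'` (Sec2Cor28iEndKnitChiCusp), with the
  -- binders `hYmap` / `hYuu` supplied by §2 / §1
  have hYmap := (map_PiYddtp_innerAutTop_ofHuuOfSection p e ιC hιC hinj op hodd s hsa hsZ hιell hN hY C hK hsH (epsPMInvχ_not_mem_range p) hι y)
  haveI := (MuTwoSetting.inversionModelχ'_compat p).GtpYdd_normal
  have hqm := isQuotientMap_toTheta_inversionModelχ' p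
  -- the automorphism pair of `y` through `ι = inclX`
  have hα : ∀ σ, (e.orbitEmbeddingOfHuuOfSection ιC hιC hinj op hodd s hsa hsZ hιell hN hY C hK hsH (epsPMInvχ_not_mem_range p)
      hι τ τ').ι (e.conjX y σ) =
      y * (e.orbitEmbeddingOfHuuOfSection ιC hιC hinj op hodd s hsa hsZ hιell hN hY C hK hsH (epsPMInvχ_not_mem_range p)
      hι τ τ').ι σ * y⁻¹ := fun σ =>
    e.orbitEmbeddingOfHuuOfSection_ι_conjX ιC hιC hinj op hodd s hsa hsZ hιell hN hY C hK hsH (epsPMInvχ_not_mem_range p)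
      hι τ τ' y σ
  have hβ := e.orbitEmbeddingOfHuu_topCompanion_toTheta hqm y
  obtain ⟨hΔ, hΔ'⟩ := (e.orbitEmbeddingOfHuuOfSection ιC hιC hinj op hodd s hsa hsZ hιell hN hY C hK hsH (epsPMInvχ_not_mem_range p)
      hι τ τ').stab_DeltaTheta_of_induces (MuTwoSetting.inversionModelχ'_compat p)
    (ThetaSetting.modelχ'_sec2Hyps p) hα hβ hind
  obtain ⟨hYs, hYs'⟩ := (e.orbitEmbeddingOfHuuOfSection ιC hιC hinj op hodd s hsa hsZ hιell hN hY C hK hsH (epsPMInvχ_not_mem_range p)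
      hι τ τ').stab_GtpYdd_of_map_PiYddtp hα hYmap
  have hXuι := e.orbitEmbeddingOfHuuOfSection_map_GtpXu ιC hιC hinj op hodd s hsa hsZ hιell hN hY C hK hsH
    (epsPMInvχ_not_mem_range p) hι τ τ'
  -- `IsStandard` is a theorem (abc-iut-f-151)
  have hstd := isStandard_ofEmbedding_orbitEmbeddingOfHuuOfSection_of_Dpt_le_sectionOfUnitχ p e ιC hιC hinj op hodd s hsa
    hsZ hιell hN hY hE C hK hsH τ τ' (MuTwoSetting.inversionModelχ'_compat p) (ThetaSetting.modelχ'_sec2Hyps p)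
    (epsPMInvχ_not_mem_range p) hι u hτ
  -- P-C5 for EVERY `y` with `σ₀ ∈ Π^tp_X` (abc-iut-w6-d083)
  obtain ⟨σ₀, -, hP⟩ := exists_autMap_symm_etaDdχ_eq_conj p (ThetaSetting.modelχ p).compat y (e.conjX y) _
    (fun g => e.inclX_conjX _ g) hβ hΔ' hYs
  have hη : ContH1Aut.autMap (MuTwoSetting.inversionModelχ' p).toTheta
        (MuTwoSetting.inversionModelχ' p).toThetaSetting.DeltaTheta (e.conjX y).symm
        (Thm16Sub.topCompanion (MuTwoSetting.inversionModelχ' p).toThetaSetting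
          (MuTwoSetting.inversionModelχ' p).toThetaSetting (e.conjX y) (e.map_deltaTemp_conjX y) hqm hqm).symm
        (symm_toTheta_eq hβ) hΔ' (H := (MuTwoSetting.inversionModelχ' p).toThetaSetting.GtpYdd)
        (H' := (MuTwoSetting.inversionModelχ' p).toThetaSetting.GtpYdd) hYs E.etaDd =
      ContH1.conj (MuTwoSetting.inversionModelχ' p).toTheta (MuTwoSetting.inversionModelχ' p).toThetaSetting.DeltaTheta
        σ₀ E.etaDd := by
    rw [hE]; exact hP
  -- the whole orbit `η̈^{Θ,ℤ×μ₂}` is stable (C1, C3)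
  have hZMu2 := (e.orbitEmbeddingOfHuuOfSection ιC hιC hinj op hodd s hsa hsZ hιell hN hY C hK hsH (epsPMInvχ_not_mem_range p)
      hι τ τ').ofEmbedding_transport_outer_etaZMu2 (MuTwoSetting.inversionModelχ'_compat p)
    (ThetaSetting.modelχ'_sec2Hyps p) hα hβ hΔ hΔ' hYs hYs' ΓΘ hind hYmap hη
  refine ⟨by rw [hZMu2]; exact hstd, fun htw => ?_, fun _ => by rw [hZMu2]; exact ThetaOrbitData.eqUpToRootOfUnity_refl _ _ _ _,
    fun h4 => ?_⟩
  · -- (C2): the tower premise gives `hYuu` (§1), the `Π^tp_{X̲̲}`-stabilities, and `y ∈ Π^tp_{C̲}` (abc-iut-f-151 §1)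
    have hYuu := (ThetaCovers.TemperedCoverData.map_PiYddtp_inf_tp_PiXuu_eq_of_tower (e.temperedCoverDataOfHuuOfSection ιC hιC hinj op hodd s hsa hsZ hιell hN hY C hK hsH (epsPMInvχ_not_mem_range p) hι) (ThetaOrbitData.innerAutTop y) htw)
    have hXuumap := htw ((e.temperedCoverDataOfHuuOfSection ιC hιC hinj op hodd s hsa hsZ hιell hN hY C hK hsH (epsPMInvχ_not_mem_range p) hι).tp
      (e.temperedCoverDataOfHuuOfSection ιC hιC hinj op hodd s hsa hsZ hιell hN hY C hK hsH (epsPMInvχ_not_mem_range p) hι).PiXuu) (by simp [ThetaCovers.TemperedCoverData.tower])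
    have hCumap := htw
      ((e.temperedCoverDataOfHuuOfSection ιC hιC hinj op hodd s hsa hsZ hιell hN hY C hK hsH (epsPMInvχ_not_mem_range p) hι).tp
        (e.temperedCoverDataOfHuuOfSection ιC hιC hinj op hodd s hsa hsZ hιell hN hY C hK hsH (epsPMInvχ_not_mem_range p) hι).PiCu)
      (by simp [ThetaCovers.TemperedCoverData.tower])
    have hyCu := ThetaCovers.TemperedCoverData.mem_tp_PiCu_of_map_innerAutTop_eq _ hCumap
    obtain ⟨hU, hU'⟩ := (e.orbitEmbeddingOfHuuOfSection ιC hιC hinj op hodd s hsa hsZ hιell hN hY C hK hsH (epsPMInvχ_not_mem_range p)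
      hι τ τ').stab_Huu_of_map_tp_PiXuu hα hXuumap
    obtain ⟨σ, hσ, hησ⟩ := exists_mem_dotXuu_pC5_inversionModelχ' p e ιC hιC hinj op hodd s hsa hsZ hιell hN hY hE C hC
      hK hsH hι τ τ' y hyCu
    rw [(e.orbitEmbeddingOfHuuOfSection ιC hιC hinj op hodd s hsa hsZ hιell hN hY C hK hsH (epsPMInvχ_not_mem_range p)
      hι τ τ').ofEmbedding_transport_outer_rootLZMu2 (MuTwoSetting.inversionModelχ'_compat p) (ThetaSetting.modelχ'_sec2Hyps p)
      hα hβ hΔ hΔ' hYs hYs' hU hU' ΓΘ hind hYuu hσ.1 (hησ hΔ' hYs)]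
    exact ThetaOrbitData.eqUpToRootOfUnity_refl _ _ _ _
  · -- (C4): the list's `Π^tp_{C̲}`-entry puts `y` in `Π^tp_{C̲}`; its `Π^tp_{X̲}`-entry gives the `Π^tp_{X̲}`-stabilities
    have hCumap := h4 ((e.temperedCoverDataOfHuuOfSection ιC hιC hinj op hodd s hsa hsZ hιell hN hY C hK hsH (epsPMInvχ_not_mem_range p) hι).tp
      (e.temperedCoverDataOfHuuOfSection ιC hιC hinj op hodd s hsa hsZ hιell hN hY C hK hsH (epsPMInvχ_not_mem_range p) hι).PiCu) (by simp)
    have hXumap := h4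
      ((e.temperedCoverDataOfHuuOfSection ιC hιC hinj op hodd s hsa hsZ hιell hN hY C hK hsH (epsPMInvχ_not_mem_range p) hι).tp
        (e.temperedCoverDataOfHuuOfSection ιC hιC hinj op hodd s hsa hsZ hιell hN hY C hK hsH (epsPMInvχ_not_mem_range p) hι).PiXu)
      (by simp)
    have hyCu := ThetaCovers.TemperedCoverData.mem_tp_PiCu_of_map_innerAutTop_eq _ hCumap
    obtain ⟨hXu, hXu'⟩ := (e.orbitEmbeddingOfHuuOfSection ιC hιC hinj op hodd s hsa hsZ hιell hN hY C hK hsH (epsPMInvχ_not_mem_range p)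
      hι τ τ').stab_GtpXu_of_map_tp_PiXu hXuι hα hXumap
    obtain ⟨σ, hσ, hησ⟩ := exists_mem_dotXuu_pC5_inversionModelχ' p e ιC hιC hinj op hodd s hsa hsZ hιell hN hY hE C hC
      hK hsH hι τ τ' y hyCu
    rw [(e.orbitEmbeddingOfHuuOfSection ιC hιC hinj op hodd s hsa hsZ hιell hN hY C hK hsH (epsPMInvχ_not_mem_range p)
      hι τ τ').ofEmbedding_transport_outer_etaLZMu2 (MuTwoSetting.inversionModelχ'_compat p) (ThetaSetting.modelχ'_sec2Hyps p)
      hα hβ hΔ hΔ' hYs hYs' hXu hXu' ΓΘ hind hYmap (C.Huu_le_GtpXu hσ.1) (hησ hΔ' hYs)]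
    exact ThetaOrbitData.eqUpToRootOfUnity_refl _ _ _ _

end EndKnit

/-! ## §5. Binder-free ∃-forms at THE cover of record, re-keyed -/

/-- **At THE cover of record** (`p ≡ 1 (mod 4)`, every odd `l`; abc-iut-L2-d3's section-route cover over `inversionModelχ′ p`, Def. 1.9
pair `τ^{±1} = tauχ′/tauInvχ′` — abc-iut-f-151's `exists_orbitEmbedding_isStandard_cor28_i_innerAutTop_inversionModelχ'` RE-KEYED):
`IsStandard` HOLDS, `Π^tp_Ÿ ⊴ Π^tp_C`, and for EVERY `y ∈ Π^tp_C` exactly one `Γ_Θ` is induced by `γ_y` and, for it, `hYmap` EXISTS and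
the body of `Cor28_i` holds with `hYuu` read off clause C2's own tower premise — residual ∅ beyond the clauses' stability premises.
[cite: MochizukiEtTh2009, Cor 2.8(i) p.42] -/
theorem exists_orbitEmbedding_isStandard_cor28_i_of_induces_inversionModelχ' (hp : p % 4 = 1) (l : ℕ+)
    (hodd : Odd ((l : ℕ+) : ℕ)) :
    ∃ (T : TemperedCoverData.{0} l) (ε : (doubleUnderlineχ'Sec p l hodd).OrbitEmbedding T),
      T.Gtp = (MuTwoSetting.inversionModelχ' p).GtpC ∧ ε.tau = (tauχ' p hp).toNonCuspidalPoint ∧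
      ε.tauInv = (tauInvχ' p hp).toNonCuspidalPoint ∧
      (ThetaOrbitData.ofEmbedding ε (MuTwoSetting.inversionModelχ'_compat p) (ThetaSetting.modelχ'_sec2Hyps p)).IsStandard ∧
      T.PiYddtp.Normal ∧
      ∀ y : T.Gtp,
        (∃! ΓΘ : (ThetaOrbitData.ofEmbedding ε (MuTwoSetting.inversionModelχ'_compat p) (ThetaSetting.modelχ'_sec2Hyps p)).DeltaTheta ≃*
            (ThetaOrbitData.ofEmbedding ε (MuTwoSetting.inversionModelχ'_compat p) (ThetaSetting.modelχ'_sec2Hyps p)).DeltaTheta,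
          (ThetaOrbitData.ofEmbedding ε (MuTwoSetting.inversionModelχ'_compat p) (ThetaSetting.modelχ'_sec2Hyps p)).InducesOnTheta (ThetaOrbitData.innerAutTop y) ΓΘ) ∧
        ∀ (ΓΘ : (ThetaOrbitData.ofEmbedding ε (MuTwoSetting.inversionModelχ'_compat p) (ThetaSetting.modelχ'_sec2Hyps p)).DeltaTheta ≃*
            (ThetaOrbitData.ofEmbedding ε (MuTwoSetting.inversionModelχ'_compat p) (ThetaSetting.modelχ'_sec2Hyps p)).DeltaTheta),
          (ThetaOrbitData.ofEmbedding ε (MuTwoSetting.inversionModelχ'_compat p) (ThetaSetting.modelχ'_sec2Hyps p)).InducesOnTheta (ThetaOrbitData.innerAutTop y) ΓΘ →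
          ∃ hYmap : T.PiYddtp.map (ThetaOrbitData.innerAutTop y).toMulEquiv.toMonoidHom = T.PiYddtp,
            (ThetaOrbitData.ofEmbedding ε (MuTwoSetting.inversionModelχ'_compat p) (ThetaSetting.modelχ'_sec2Hyps p)).IsStandardColl
                ((ThetaOrbitData.ofEmbedding ε (MuTwoSetting.inversionModelχ'_compat p) (ThetaSetting.modelχ'_sec2Hyps p)).transport _ (ThetaOrbitData.innerAutTop y) hYmap ΓΘ (ThetaOrbitData.ofEmbedding ε (MuTwoSetting.inversionModelχ'_compat p) (ThetaSetting.modelχ'_sec2Hyps p)).etaZMu2) ∧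
              (∀ htw : (∀ S ∈ T.tower, S.map (ThetaOrbitData.innerAutTop y).toMulEquiv.toMonoidHom = S),
                (ThetaOrbitData.ofEmbedding ε (MuTwoSetting.inversionModelχ'_compat p) (ThetaSetting.modelχ'_sec2Hyps p)).EqUpToRootOfUnity l _ (ThetaOrbitData.ofEmbedding ε (MuTwoSetting.inversionModelχ'_compat p) (ThetaSetting.modelχ'_sec2Hyps p)).rootLZMu2
                  ((ThetaOrbitData.ofEmbedding ε (MuTwoSetting.inversionModelχ'_compat p) (ThetaSetting.modelχ'_sec2Hyps p)).transport _ (ThetaOrbitData.innerAutTop y) (ThetaCovers.TemperedCoverData.map_PiYddtp_inf_tp_PiXuu_eq_of_tower T (ThetaOrbitData.innerAutTop y) htw) ΓΘ (ThetaOrbitData.ofEmbedding ε (MuTwoSetting.inversionModelχ'_compat p) (ThetaSetting.modelχ'_sec2Hyps p)).rootLZMu2)) ∧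
              ((∀ S ∈ [T.tp T.PiXu, T.tp T.PiX, T.PiYddtp],
                  S.map (ThetaOrbitData.innerAutTop y).toMulEquiv.toMonoidHom = S) →
                (ThetaOrbitData.ofEmbedding ε (MuTwoSetting.inversionModelχ'_compat p) (ThetaSetting.modelχ'_sec2Hyps p)).EqUpToRootOfUnity 1 _ (ThetaOrbitData.ofEmbedding ε (MuTwoSetting.inversionModelχ'_compat p) (ThetaSetting.modelχ'_sec2Hyps p)).etaZMu2
                  ((ThetaOrbitData.ofEmbedding ε (MuTwoSetting.inversionModelχ'_compat p) (ThetaSetting.modelχ'_sec2Hyps p)).transport _ (ThetaOrbitData.innerAutTop y) hYmap ΓΘ (ThetaOrbitData.ofEmbedding ε (MuTwoSetting.inversionModelχ'_compat p) (ThetaSetting.modelχ'_sec2Hyps p)).etaZMu2)) ∧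
              ((∀ S ∈ [T.tp T.PiCu, T.tp T.PiXu, T.tp T.PiX, T.PiYddtp],
                  S.map (ThetaOrbitData.innerAutTop y).toMulEquiv.toMonoidHom = S) →
                (ThetaOrbitData.ofEmbedding ε (MuTwoSetting.inversionModelχ'_compat p) (ThetaSetting.modelχ'_sec2Hyps p)).EqUpToRootOfUnity 1 _ (ThetaOrbitData.ofEmbedding ε (MuTwoSetting.inversionModelχ'_compat p) (ThetaSetting.modelχ'_sec2Hyps p)).etaLZMu2
                  ((ThetaOrbitData.ofEmbedding ε (MuTwoSetting.inversionModelχ'_compat p) (ThetaSetting.modelχ'_sec2Hyps p)).transport _ (ThetaOrbitData.innerAutTop y) hYmap ΓΘ (ThetaOrbitData.ofEmbedding ε (MuTwoSetting.inversionModelχ'_compat p) (ThetaSetting.modelχ'_sec2Hyps p)).etaLZMu2)) := by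
  obtain ⟨eX⟩ := nonempty_oncePuncturedData_modelχ' p
  refine ⟨_, _, rfl, rfl, rfl, isStandard_coverOfRecordχ'_tauχ' p hp l hodd eX,
    piYddtp_normal_ofHuuOfSection p (cLevelDataInvχ' p) _ _ _ eX hodd _ _ _ _ _ _ (doubleUnderlineχ'Sec p l hodd) _ _ _ _,
    fun y => ⟨existsUnique_inducesOnTheta_innerAutTop_ofHuuOfSection p (cLevelDataInvχ' p) _ _ _ eX hodd _ _ _ _ _ _
      (doubleUnderlineχ'Sec p l hodd) _ _ _ _ _ _ y, fun ΓΘ hind => ⟨_,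
      cor28_i_innerAutTop_endKnit_inversionModelχ'_of_induces p (cLevelDataInvχ' p) _ _ _ eX hodd _ _ _ _ _ _ rfl
        (doubleUnderlineχ'Sec p l hodd) rfl _ _ _ _ _ (sqrtNegOneUnitχ p hp) (Dpt_tauχ' p hp).le y ΓΘ hind⟩⟩⟩

/-- **The same for EVERY prime `p`** (every odd `l`), both slots of the orbit embedding filled by abc-iut-w5-d118's anchored point
`anchoredPointχ′OfUnit (1+p)` (HONEST LABEL: a slot filling, not the Def. 1.9 pair; abc-iut-f-151's `…_all` RE-KEYED).
[cite: MochizukiEtTh2009, Cor 2.8(i) p.42] -/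
theorem exists_orbitEmbedding_isStandard_cor28_i_of_induces_inversionModelχ'_all (l : ℕ+) (hodd : Odd ((l : ℕ+) : ℕ)) :
    ∃ (T : TemperedCoverData.{0} l) (ε : (doubleUnderlineχ'Sec p l hodd).OrbitEmbedding T),
      T.Gtp = (MuTwoSetting.inversionModelχ' p).GtpC ∧ ε.tau = (anchoredPointχ'OfUnit p (onePlusP p) (onePlusP_ne_cusp p)).toNonCuspidalPoint ∧
      (ThetaOrbitData.ofEmbedding ε (MuTwoSetting.inversionModelχ'_compat p) (ThetaSetting.modelχ'_sec2Hyps p)).IsStandard ∧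
      T.PiYddtp.Normal ∧
      ∀ y : T.Gtp,
        (∃! ΓΘ : (ThetaOrbitData.ofEmbedding ε (MuTwoSetting.inversionModelχ'_compat p) (ThetaSetting.modelχ'_sec2Hyps p)).DeltaTheta ≃*
            (ThetaOrbitData.ofEmbedding ε (MuTwoSetting.inversionModelχ'_compat p) (ThetaSetting.modelχ'_sec2Hyps p)).DeltaTheta,
          (ThetaOrbitData.ofEmbedding ε (MuTwoSetting.inversionModelχ'_compat p) (ThetaSetting.modelχ'_sec2Hyps p)).InducesOnTheta (ThetaOrbitData.innerAutTop y) ΓΘ) ∧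
        ∀ (ΓΘ : (ThetaOrbitData.ofEmbedding ε (MuTwoSetting.inversionModelχ'_compat p) (ThetaSetting.modelχ'_sec2Hyps p)).DeltaTheta ≃*
            (ThetaOrbitData.ofEmbedding ε (MuTwoSetting.inversionModelχ'_compat p) (ThetaSetting.modelχ'_sec2Hyps p)).DeltaTheta),
          (ThetaOrbitData.ofEmbedding ε (MuTwoSetting.inversionModelχ'_compat p) (ThetaSetting.modelχ'_sec2Hyps p)).InducesOnTheta (ThetaOrbitData.innerAutTop y) ΓΘ →
          ∃ hYmap : T.PiYddtp.map (ThetaOrbitData.innerAutTop y).toMulEquiv.toMonoidHom = T.PiYddtp,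
            (ThetaOrbitData.ofEmbedding ε (MuTwoSetting.inversionModelχ'_compat p) (ThetaSetting.modelχ'_sec2Hyps p)).IsStandardColl
                ((ThetaOrbitData.ofEmbedding ε (MuTwoSetting.inversionModelχ'_compat p) (ThetaSetting.modelχ'_sec2Hyps p)).transport _ (ThetaOrbitData.innerAutTop y) hYmap ΓΘ (ThetaOrbitData.ofEmbedding ε (MuTwoSetting.inversionModelχ'_compat p) (ThetaSetting.modelχ'_sec2Hyps p)).etaZMu2) ∧
              (∀ htw : (∀ S ∈ T.tower, S.map (ThetaOrbitData.innerAutTop y).toMulEquiv.toMonoidHom = S),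
                (ThetaOrbitData.ofEmbedding ε (MuTwoSetting.inversionModelχ'_compat p) (ThetaSetting.modelχ'_sec2Hyps p)).EqUpToRootOfUnity l _ (ThetaOrbitData.ofEmbedding ε (MuTwoSetting.inversionModelχ'_compat p) (ThetaSetting.modelχ'_sec2Hyps p)).rootLZMu2
                  ((ThetaOrbitData.ofEmbedding ε (MuTwoSetting.inversionModelχ'_compat p) (ThetaSetting.modelχ'_sec2Hyps p)).transport _ (ThetaOrbitData.innerAutTop y) (ThetaCovers.TemperedCoverData.map_PiYddtp_inf_tp_PiXuu_eq_of_tower T (ThetaOrbitData.innerAutTop y) htw) ΓΘ (ThetaOrbitData.ofEmbedding ε (MuTwoSetting.inversionModelχ'_compat p) (ThetaSetting.modelχ'_sec2Hyps p)).rootLZMu2)) ∧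
              ((∀ S ∈ [T.tp T.PiXu, T.tp T.PiX, T.PiYddtp],
                  S.map (ThetaOrbitData.innerAutTop y).toMulEquiv.toMonoidHom = S) →
                (ThetaOrbitData.ofEmbedding ε (MuTwoSetting.inversionModelχ'_compat p) (ThetaSetting.modelχ'_sec2Hyps p)).EqUpToRootOfUnity 1 _ (ThetaOrbitData.ofEmbedding ε (MuTwoSetting.inversionModelχ'_compat p) (ThetaSetting.modelχ'_sec2Hyps p)).etaZMu2
                  ((ThetaOrbitData.ofEmbedding ε (MuTwoSetting.inversionModelχ'_compat p) (ThetaSetting.modelχ'_sec2Hyps p)).transport _ (ThetaOrbitData.innerAutTop y) hYmap ΓΘ (ThetaOrbitData.ofEmbedding ε (MuTwoSetting.inversionModelχ'_compat p) (ThetaSetting.modelχ'_sec2Hyps p)).etaZMu2)) ∧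
              ((∀ S ∈ [T.tp T.PiCu, T.tp T.PiXu, T.tp T.PiX, T.PiYddtp],
                  S.map (ThetaOrbitData.innerAutTop y).toMulEquiv.toMonoidHom = S) →
                (ThetaOrbitData.ofEmbedding ε (MuTwoSetting.inversionModelχ'_compat p) (ThetaSetting.modelχ'_sec2Hyps p)).EqUpToRootOfUnity 1 _ (ThetaOrbitData.ofEmbedding ε (MuTwoSetting.inversionModelχ'_compat p) (ThetaSetting.modelχ'_sec2Hyps p)).etaLZMu2
                  ((ThetaOrbitData.ofEmbedding ε (MuTwoSetting.inversionModelχ'_compat p) (ThetaSetting.modelχ'_sec2Hyps p)).transport _ (ThetaOrbitData.innerAutTop y) hYmap ΓΘ (ThetaOrbitData.ofEmbedding ε (MuTwoSetting.inversionModelχ'_compat p) (ThetaSetting.modelχ'_sec2Hyps p)).etaLZMu2)) := by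
  obtain ⟨eX⟩ := nonempty_oncePuncturedData_modelχ' p
  refine ⟨_, _, rfl, rfl, isStandard_coverOfRecordχ'_anchoredPointχ'OfUnit p l hodd eX,
    piYddtp_normal_ofHuuOfSection p (cLevelDataInvχ' p) _ _ _ eX hodd _ _ _ _ _ _ (doubleUnderlineχ'Sec p l hodd) _ _ _ _,
    fun y => ⟨existsUnique_inducesOnTheta_innerAutTop_ofHuuOfSection p (cLevelDataInvχ' p) _ _ _ eX hodd _ _ _ _ _ _
      (doubleUnderlineχ'Sec p l hodd) _ _ _ _ _ _ y, fun ΓΘ hind => ⟨_,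
      cor28_i_innerAutTop_endKnit_inversionModelχ'_of_induces p (cLevelDataInvχ' p) _ _ _ eX hodd _ _ _ _ _ _ rfl
        (doubleUnderlineχ'Sec p l hodd) rfl _ _ _ _ _ (onePlusP p) (Dpt_anchoredPointχ'OfUnit p _ _).le y ΓΘ hind⟩⟩⟩

end SettingModel

end Literature.AnabelianGeometry.EtaleTheta

end
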